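import Mathlib
import HarnessLib
import Summits.Ventures.LatticeQCDFlow.Exactness.SphereLocalFieldFrozenMoments
import Summits.Ventures.LatticeQCDFlow.Exactness.LatticeCoordAvg

/-!
# The conditional mean of the static block term given a coupled pair of spins: `E[V_I | ω_k, ω_l] = K − 2·(2κ²/(d−1))·⟪ω_k, U_{kl} ω_l⟫²`, and its variance `4(2κ²/(d−1))²·Var(⟪ω_k, U_{kl} ω_l⟫²)`

HONEST FRAMING: exact (Metropolis-corrected) sampling algorithms for lattice gauge theory;
figures of merit are autocorrelation/cost numbers at stated couplings and volumes; no
continuum-physics claim.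

Venture `LatticeQCDFlow` (cell pub-lqcd), topic `Exactness`; FANOUT row 7 (`s0-cpn-null`).  NEW WORK
of the cell over this lineage's `Exactness/SphereLocalFieldFrozenMoments.lean` (the three lattice
integrals of the local field against a frozen vector), the tree's `Exactness/SphereActionVariance.lean`
(`‖U‖²_HS` sums), `Exactness/LatticeCoordAvg.lean` (the coordinate average `A_s`, `E[A_s G] = E[G]`),
`Exactness/SphereLOFlowAction.lean` (`localField`, no self-coupling) and
`Exactness/SphereGeodesicKick.lean` (`‖P_x J‖² = ‖J‖² − ⟪J, x⟫²`); nothing is cited as a fact.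
Printed counterpart, NAMED ONLY: Engel–Schaefer, Comput. Phys. Commun. 182 (2011) 2107, §2 eqs.
(6)–(7), (13) (the action, the local field `J_n`, the force `2Nβ p_n`).  The point: the block terms of
this lineage's extensive floor for the reverse relative entropy of the exact leading-order flow
sampler are bounded below through CONDITIONAL VARIANCES OF THE STATIC BLOCK TERM
`V_I = Σ_{n∈I} v_n`, `v_n = (2κ²/(d−1))‖p_n‖²`, GIVEN DISJOINT GROUPS OF SPINS
(`Exactness/SphereLOFlowEntropyFloorPairs`); here the two-site conditional mean
`E[V_I | ω_k, ω_l] = A_{Λ∖{k,l}} V_I` is computed in closed form for a COUPLED PAIR `{k, l} ⊆ I` of a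
lattice with scaled-isometric links (`‖U_{nm} v‖ = β_{nm}‖v‖` — the CP(N−1)/O(N) transporters) and
no common neighbour of `k` and `l` (triangle-free, e.g. nearest neighbours of `ℤ²`): it is a constant
minus `2·(2κ²/(d−1))·⟪ω_k, U_{kl} ω_l⟫²` (one-site conditional means are constant — the first
Hoeffding chaos of `V_I` vanishes — so two sites are the first informative conditioning), whence
`Var(E[V_I | ω_k, ω_l]) = 4(2κ²/(d−1))²·Var_π̄(⟪ω_k, U_{kl} ω_l⟫²)`, a flow-free, volume-free
two-spin integral.

## Setting

`E` finite-dimensional real inner product space, `d = dim E ≥ 2`; `Λ` finite; `Ω = S(E)^Λ`,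
`π̄ = ⊗_Λ σ̄` (`σ̄ = uniformSphere volume`); couplings `U : Λ → Λ → (E →L[ℝ] E)` with no
self-coupling (`U_{nn} = 0`), adjoint pairs (`⟪U_{mn} v, w⟫ = ⟪v, U_{nm} w⟫`) and scaled-isometric
links (`‖U_{nm} v‖ = β_{nm}‖v‖`); `J_n = localField U n`; `p_n = tangentKick (J_n x) x_n`;
`A_s = coordAvg σ̄ s`; `b = stdOrthonormalBasis ℝ E`.  For a pair `k ≠ l` the TRUNCATED couplings
`U⁰_{nm} = [m ∉ {k,l}]·U_{nm}` appear in the constants only.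

## Content

* §1 `sum_eq_pair_add_sum_sdiff`; **`localField_pair_piecewise`** — the local field of the
  configuration glued from `ω'` off `{k,l}` and `ω` on `{k,l}`: `J_n = J⁰_n(ω') + (U_{nk}ω_k + U_{nl}ω_l)`.
* §2 `norm_sq_pair_field`; **`integral_loCarreSite_pair_piecewise_far`** (a site `n ∉ {k,l}` without a
  common link to both: its conditional mean given `ω_k, ω_l` is a constant),
  **`integral_loCarreSite_pair_piecewise_near`** (the site `k`: constant `− (2κ²/(d−1))⟪ω_k, U_{kl}ω_l⟫²`),
  **`coordAvg_pair_loCarreBlock_eq`** (`A_{Λ∖{k,l}} V_I = K − 2(2κ²/(d−1))⟪ω_k, U_{kl}ω_l⟫²`,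
  `k, l ∈ I`), **`variance_coordAvg_pair_loCarreBlock_eq`**
  (`Var(A_{Λ∖{k,l}} V_I) = 4(2κ²/(d−1))²·Var(⟪ω_k, U_{kl}ω_l⟫²)`).

NOT CLAIMED: the value of `Var(⟪ω_k, U_{kl}ω_l⟫²)` (tree: `Exactness/SphereLatticeFourthMoment`,
`2(d−1)β⁴/(d²(d+2))`, to be combined in a sequel); pairs with a common neighbour; anything about the
flow, the entropy floor itself, or numbers.
-/

noncomputable section

namespace Summit.Ventures.LatticeQCDFlow.Exactness

open Function Set Metric MeasureTheory NormedSpace InnerProductSpace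
open scoped RealInnerProductSpace

variable {Λ : Type*} {E : Type*} [NormedAddCommGroup E] [InnerProductSpace ℝ E]
  [FiniteDimensional ℝ E] [MeasurableSpace E] [BorelSpace E] [Fintype Λ] [DecidableEq Λ]

/-! ## §1 The local field of a configuration glued along a pair of sites -/

section Glue

variable {U : Λ → Λ → (E →L[ℝ] E)} {k l : Λ}

omit [Fintype Λ] in
/-- `Σ_m f m = f k + f l + Σ_{m ∉ {k,l}} f m` for `k ≠ l`. -/
theorem sum_eq_pair_add_sum_sdiff [Fintype Λ] {M : Type*} [AddCommMonoid M] (hkl : k ≠ l)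
    (f : Λ → M) : ∑ m, f m = f k + f l + ∑ m ∈ Finset.univ \ {k, l}, f m := by
  have h := Finset.sum_sdiff (f := f) (Finset.subset_univ ({k, l} : Finset Λ))
  rw [Finset.sum_pair hkl] at h
  rw [← h, add_comm]

omit [FiniteDimensional ℝ E] [MeasurableSpace E] [BorelSpace E] in
/-- **The local field of the glued configuration.**  Glue `ω'` (off `{k,l}`) to `ω` (on `{k,l}`); then
`J_n = J⁰_n(ω') + (U_{nk} ω_k + U_{nl} ω_l)` with the truncated couplings
`U⁰_{nm} = [m ∉ {k,l}]·U_{nm}`. -/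
theorem localField_pair_piecewise (hkl : k ≠ l) (n : Λ) (ω ω' : Λ → sphere (0 : E) 1) :
    localField U n (fun i => (((Finset.univ \ {k, l}).piecewise ω' ω) i : E)) =
      localField (fun n m => if m ∈ ({k, l} : Finset Λ) then (0 : E →L[ℝ] E) else U n m) n
          (fun i => ((ω' i : sphere (0 : E) 1) : E)) + (U n k (ω k : E) + U n l (ω l : E)) := by
  simp only [localField]
  rw [sum_eq_pair_add_sum_sdiff hkl
      (fun m => U n m ((((Finset.univ \ {k, l}).piecewise ω' ω) m : sphere (0 : E) 1) : E)),
    sum_eq_pair_add_sum_sdiff hkl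
      (fun m => (if m ∈ ({k, l} : Finset Λ) then (0 : E →L[ℝ] E) else U n m) ((ω' m : sphere (0 : E) 1) : E))]
  have hkA : k ∉ Finset.univ \ ({k, l} : Finset Λ) := by simp
  have hlA : l ∉ Finset.univ \ ({k, l} : Finset Λ) := by simp
  simp only [Finset.piecewise_eq_of_notMem _ _ _ hkA, Finset.piecewise_eq_of_notMem _ _ _ hlA,
    Finset.mem_insert, Finset.mem_singleton, true_or, or_true, if_true,
    zero_apply, zero_add]
  have hS : ∑ m ∈ Finset.univ \ {k, l},
      U n m ((((Finset.univ \ {k, l}).piecewise ω' ω) m : sphere (0 : E) 1) : E) =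
      ∑ m ∈ Finset.univ \ {k, l},
        (if m = k ∨ m = l then (0 : E →L[ℝ] E) else U n m) ((ω' m : sphere (0 : E) 1) : E) := by
    refine Finset.sum_congr rfl fun m hm => ?_
    have hm' : ¬ (m = k ∨ m = l) := by simpa [Finset.mem_sdiff] using hm
    rw [Finset.piecewise_eq_of_mem _ _ _ hm, if_neg hm']
  rw [hS]
  abel

end Glue

/-! ## §2 The conditional mean of the static block term given a coupled pair, and its variance -/

section Pair

variable [Nontrivial E] {U : Λ → Λ → (E →L[ℝ] E)} {β : Λ → Λ → ℝ} {k l : Λ}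

omit [FiniteDimensional ℝ E] [MeasurableSpace E] [BorelSpace E] [Fintype Λ] [DecidableEq Λ]
  [Nontrivial E] in
/-- Scaled-isometric links without a common neighbour: `‖U_{nk} a + U_{nl} b‖² = β_{nk}² + β_{nl}²` for
unit `a`, `b` when `U_{nk} = 0` or `U_{nl} = 0`. -/
theorem norm_sq_pair_field (hβ : ∀ n m (v : E), ‖U n m v‖ = β n m * ‖v‖) {n : Λ}
    (htri : U n k = 0 ∨ U n l = 0) {a b : E} (ha : ‖a‖ = 1) (hb : ‖b‖ = 1) :
    ‖U n k a + U n l b‖ ^ 2 = β n k ^ 2 + β n l ^ 2 := by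
  rcases htri with h | h
  · have h0 := hβ n k a
    rw [h, zero_apply, norm_zero, ha, mul_one] at h0
    rw [h, zero_apply, zero_add, hβ n l b, hb, mul_one, ← h0]
    ring
  · have h0 := hβ n l b
    rw [h, zero_apply, norm_zero, hb, mul_one] at h0
    rw [h, zero_apply, add_zero, hβ n k a, ha, mul_one, ← h0]
    ring

/-- **A FAR SITE: its conditional mean given `ω_k, ω_l` is a constant.**  For `n ∉ {k, l}` with no
self-coupling, scaled-isometric links and no common link to both `k` and `l`:
`∫ v_n(ω' glued to ω on {k,l}) dπ̄(ω') = (2κ²/(d−1))·(1 − 1/d)·(Σ_m ‖U⁰_{nm}‖²_HS/d + β_{nk}² + β_{nl}²)`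
(`x_n` is integrated: `E⟪J, x_n⟫² = ‖J‖²/d`). -/
theorem integral_loCarreSite_pair_piecewise_far (h2 : 2 ≤ Module.finrank ℝ E) (hU0 : ∀ n, U n n = 0)
    (hβ : ∀ n m (v : E), ‖U n m v‖ = β n m * ‖v‖) (hkl : k ≠ l) {n : Λ} (hnk : n ≠ k) (hnl : n ≠ l)
    (htri : U n k = 0 ∨ U n l = 0) (κ : ℝ) (ω : Λ → sphere (0 : E) 1) :
    ∫ ω', 2 * κ ^ 2 / ((Module.finrank ℝ E : ℝ) - 1) *
        ‖tangentKick (localField U n (fun i => ((((Finset.univ \ {k, l}).piecewise ω' ω) i :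
            sphere (0 : E) 1) : E))) ((((Finset.univ \ {k, l}).piecewise ω' ω) n : sphere (0 : E) 1) : E)‖ ^ 2
        ∂Measure.pi (fun _ : Λ => uniformSphere (volume : Measure E)) =
      2 * κ ^ 2 / ((Module.finrank ℝ E : ℝ) - 1) * ((1 - 1 / (Module.finrank ℝ E : ℝ)) *
        ((∑ m, ∑ i, ‖(if m ∈ ({k, l} : Finset Λ) then (0 : E →L[ℝ] E) else U n m)
            (stdOrthonormalBasis ℝ E i)‖ ^ 2) / (Module.finrank ℝ E : ℝ) + (β n k ^ 2 + β n l ^ 2))) := by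
  have hd : (0 : ℝ) < (Module.finrank ℝ E : ℝ) := by exact_mod_cast Module.finrank_pos
  set U0 : Λ → Λ → (E →L[ℝ] E) := fun n m => if m ∈ ({k, l} : Finset Λ) then 0 else U n m with hU0def
  have hU00 : ∀ n, U0 n n = 0 := fun n => by
    simp only [hU0def]
    split_ifs
    · rfl
    · exact hU0 n
  have hnA : n ∈ Finset.univ \ ({k, l} : Finset Λ) := by simp [hnk, hnl]
  set F : E := U n k (ω k : E) + U n l (ω l : E) with hFdef
  have hFn : ‖F‖ ^ 2 = β n k ^ 2 + β n l ^ 2 :=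
    norm_sq_pair_field hβ htri (norm_eq_of_mem_sphere (ω k)) (norm_eq_of_mem_sphere (ω l))
  -- rewrite the integrand through the glued local field and `‖P_x J‖² = ‖J‖² − ⟪J, x⟫²`
  have hpt : ∀ ω' : Λ → sphere (0 : E) 1,
      2 * κ ^ 2 / ((Module.finrank ℝ E : ℝ) - 1) *
        ‖tangentKick (localField U n (fun i => ((((Finset.univ \ {k, l}).piecewise ω' ω) i :
            sphere (0 : E) 1) : E))) ((((Finset.univ \ {k, l}).piecewise ω' ω) n : sphere (0 : E) 1) : E)‖ ^ 2 =
      2 * κ ^ 2 / ((Module.finrank ℝ E : ℝ) - 1) *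
        (‖localField U0 n (fun i => (ω' i : E)) + F‖ ^ 2 -
          ⟪localField U0 n (fun i => (ω' i : E)) + F, ((ω' n : sphere (0 : E) 1) : E)⟫ ^ 2) := by
    intro ω'
    rw [localField_pair_piecewise hkl n ω ω', Finset.piecewise_eq_of_mem _ _ _ hnA,
      norm_tangentKick_sq _ (norm_eq_of_mem_sphere (ω' n))]
  simp_rw [hpt]
  have hJc : Continuous fun ω' : Λ → sphere (0 : E) 1 => localField U0 n (fun i => (ω' i : E)) + F :=
    ((contDiff_localField U0 n (m := 0)).continuous.comp continuous_sphereConfig).add continuous_const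
  have hI1 : Integrable (fun ω' : Λ → sphere (0 : E) 1 => ‖localField U0 n (fun i => (ω' i : E)) + F‖ ^ 2)
      (Measure.pi fun _ : Λ => uniformSphere (volume : Measure E)) :=
    integrable_pi_of_continuous _ (hJc.norm.pow 2)
  have hI2 : Integrable (fun ω' : Λ → sphere (0 : E) 1 =>
      ⟪localField U0 n (fun i => (ω' i : E)) + F, ((ω' n : sphere (0 : E) 1) : E)⟫ ^ 2)
      (Measure.pi fun _ : Λ => uniformSphere (volume : Measure E)) :=
    integrable_pi_of_continuous _ ((hJc.inner (continuous_subtype_val.comp (continuous_apply n))).pow 2)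
  rw [integral_const_mul, integral_sub hI1 hI2]
  have hX := integral_norm_sq_localField_add_const h2 U0 n F
  have hY := finrank_mul_integral_sq_inner_localField_add_const (U := U0) hU00 n F
  rw [hX] at hY ⊢
  have hY' : ∫ ω', ⟪localField U0 n (fun i => ((ω' : Λ → sphere (0 : E) 1) i : E)) + F,
      ((ω' n : sphere (0 : E) 1) : E)⟫ ^ 2 ∂Measure.pi (fun _ : Λ => uniformSphere (volume : Measure E)) =
      ((∑ m, ∑ i, ‖U0 n m (stdOrthonormalBasis ℝ E i)‖ ^ 2) / (Module.finrank ℝ E : ℝ) + ‖F‖ ^ 2) /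
        (Module.finrank ℝ E : ℝ) := by
    rw [eq_div_iff hd.ne', mul_comm]
    exact hY
  rw [hY', hFn]
  field_simp
  ring

/-- **THE PINNED SITE `k`: its conditional mean given `ω_k, ω_l` is a constant minus
`(2κ²/(d−1))·⟪ω_k, U_{kl} ω_l⟫²`** (no self-coupling, adjoint pairs, scaled-isometric links):
`∫ v_k(ω' glued to ω on {k,l}) dπ̄(ω') =
(2κ²/(d−1))·(Σ_m ‖U⁰_{km}‖²_HS/d + β_{kl}² − Σ_{m∉{k,l}} β_{mk}²/d) − (2κ²/(d−1))·⟪ω_k, U_{kl} ω_l⟫²`. -/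
theorem integral_loCarreSite_pair_piecewise_near (h2 : 2 ≤ Module.finrank ℝ E) (hU0 : ∀ n, U n n = 0)
    (hUadj : ∀ m n (v w : E), ⟪U m n v, w⟫ = ⟪v, U n m w⟫)
    (hβ : ∀ n m (v : E), ‖U n m v‖ = β n m * ‖v‖) (hkl : k ≠ l) (κ : ℝ) (ω : Λ → sphere (0 : E) 1) :
    ∫ ω', 2 * κ ^ 2 / ((Module.finrank ℝ E : ℝ) - 1) *
        ‖tangentKick (localField U k (fun i => ((((Finset.univ \ {k, l}).piecewise ω' ω) i :
            sphere (0 : E) 1) : E))) ((((Finset.univ \ {k, l}).piecewise ω' ω) k : sphere (0 : E) 1) : E)‖ ^ 2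
        ∂Measure.pi (fun _ : Λ => uniformSphere (volume : Measure E)) =
      2 * κ ^ 2 / ((Module.finrank ℝ E : ℝ) - 1) *
          ((∑ m, ∑ i, ‖(if m ∈ ({k, l} : Finset Λ) then (0 : E →L[ℝ] E) else U k m)
              (stdOrthonormalBasis ℝ E i)‖ ^ 2) / (Module.finrank ℝ E : ℝ) + β k l ^ 2 -
            (∑ m ∈ Finset.univ \ {k, l}, β m k ^ 2) / (Module.finrank ℝ E : ℝ)) -
        2 * κ ^ 2 / ((Module.finrank ℝ E : ℝ) - 1) * ⟪((ω k : sphere (0 : E) 1) : E), U k l (ω l : E)⟫ ^ 2 := by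
  set U0 : Λ → Λ → (E →L[ℝ] E) := fun n m => if m ∈ ({k, l} : Finset Λ) then 0 else U n m with hU0def
  have hkA : k ∉ Finset.univ \ ({k, l} : Finset Λ) := by simp
  set F : E := U k k (ω k : E) + U k l (ω l : E) with hFdef
  have hF : F = U k l (ω l : E) := by rw [hFdef, hU0 k, zero_apply, zero_add]
  have hFn : ‖F‖ ^ 2 = β k l ^ 2 := by rw [hF, hβ k l, norm_eq_of_mem_sphere (ω l), mul_one]
  have hFk : ⟪F, ((ω k : sphere (0 : E) 1) : E)⟫ = ⟪((ω k : sphere (0 : E) 1) : E), U k l (ω l : E)⟫ := by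
    rw [hF, real_inner_comm]
  have hpt : ∀ ω' : Λ → sphere (0 : E) 1,
      2 * κ ^ 2 / ((Module.finrank ℝ E : ℝ) - 1) *
        ‖tangentKick (localField U k (fun i => ((((Finset.univ \ {k, l}).piecewise ω' ω) i :
            sphere (0 : E) 1) : E))) ((((Finset.univ \ {k, l}).piecewise ω' ω) k : sphere (0 : E) 1) : E)‖ ^ 2 =
      2 * κ ^ 2 / ((Module.finrank ℝ E : ℝ) - 1) *
        (‖localField U0 k (fun i => (ω' i : E)) + F‖ ^ 2 -
          ⟪localField U0 k (fun i => (ω' i : E)) + F, ((ω k : sphere (0 : E) 1) : E)⟫ ^ 2) := by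
    intro ω'
    rw [localField_pair_piecewise hkl k ω ω', Finset.piecewise_eq_of_notMem _ _ _ hkA,
      norm_tangentKick_sq _ (norm_eq_of_mem_sphere (ω k))]
  simp_rw [hpt]
  have hJc : Continuous fun ω' : Λ → sphere (0 : E) 1 => localField U0 k (fun i => (ω' i : E)) + F :=
    ((contDiff_localField U0 k (m := 0)).continuous.comp continuous_sphereConfig).add continuous_const
  have hI1 : Integrable (fun ω' : Λ → sphere (0 : E) 1 => ‖localField U0 k (fun i => (ω' i : E)) + F‖ ^ 2)
      (Measure.pi fun _ : Λ => uniformSphere (volume : Measure E)) :=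
    integrable_pi_of_continuous _ (hJc.norm.pow 2)
  have hI2 : Integrable (fun ω' : Λ → sphere (0 : E) 1 =>
      ⟪localField U0 k (fun i => (ω' i : E)) + F, ((ω k : sphere (0 : E) 1) : E)⟫ ^ 2)
      (Measure.pi fun _ : Λ => uniformSphere (volume : Measure E)) :=
    integrable_pi_of_continuous _ ((hJc.inner continuous_const).pow 2)
  rw [integral_const_mul, integral_sub hI1 hI2, integral_norm_sq_localField_add_const h2 U0 k F,
    integral_sq_inner_localField_add_const h2 U0 k F ((ω k : sphere (0 : E) 1) : E), hFn, hFk]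
  -- the adjoint sum: `U⁰_{km}† = U_{mk}` off the pair (adjoint pairs), `0` on it; scaled isometries
  have hadj : ∑ m, ‖ContinuousLinearMap.adjoint (U0 k m) ((ω k : sphere (0 : E) 1) : E)‖ ^ 2 =
      ∑ m ∈ Finset.univ \ {k, l}, β m k ^ 2 := by
    rw [sum_eq_pair_add_sum_sdiff hkl]
    have hz : ∀ m, m ∈ ({k, l} : Finset Λ) →
        ‖ContinuousLinearMap.adjoint (U0 k m) ((ω k : sphere (0 : E) 1) : E)‖ ^ 2 = 0 := by
      intro m hm
      simp only [hU0def, if_pos hm, map_zero, zero_apply, norm_zero]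
      ring
    rw [hz k (by simp), hz l (by simp), zero_add, zero_add]
    refine Finset.sum_congr rfl fun m hm => ?_
    have hm' : m ∉ ({k, l} : Finset Λ) := (Finset.mem_sdiff.1 hm).2
    have hadjm : U m k = ContinuousLinearMap.adjoint (U0 k m) := by
      rw [ContinuousLinearMap.eq_adjoint_iff]
      intro v w'
      simp only [hU0def, if_neg hm']
      exact hUadj m k v w'
    rw [← hadjm, hβ m k, norm_eq_of_mem_sphere (ω k), mul_one]
  rw [hadj]
  ring

/-- **THE CONDITIONAL MEAN OF THE STATIC BLOCK TERM GIVEN A COUPLED PAIR.**  No self-coupling, adjoint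
pairs, scaled-isometric links, `k ≠ l` without a common neighbour (`U_{nk} = 0` or `U_{nl} = 0` for every
`n`), `k, l ∈ I`.  Then there is a constant `K` with
`A_{Λ∖{k,l}} V_I (ω) = E[V_I | ω_k, ω_l] = K − 2·(2κ²/(d−1))·⟪ω_k, U_{kl} ω_l⟫²` for every `ω ∈ Ω`. -/
theorem coordAvg_pair_loCarreBlock_eq (h2 : 2 ≤ Module.finrank ℝ E) (hU0 : ∀ n, U n n = 0)
    (hUadj : ∀ m n (v w : E), ⟪U m n v, w⟫ = ⟪v, U n m w⟫)
    (hβ : ∀ n m (v : E), ‖U n m v‖ = β n m * ‖v‖) (hkl : k ≠ l) (htri : ∀ n, U n k = 0 ∨ U n l = 0)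
    {I : Finset Λ} (hkI : k ∈ I) (hlI : l ∈ I) (κ : ℝ) :
    ∃ K : ℝ, ∀ ω : Λ → sphere (0 : E) 1,
      coordAvg (uniformSphere (volume : Measure E)) (Finset.univ \ {k, l}) (fun ω => ∑ n ∈ I,
          2 * κ ^ 2 / ((Module.finrank ℝ E : ℝ) - 1) *
            ‖tangentKick (localField U n (fun i => ((ω i : sphere (0 : E) 1) : E))) (ω n : E)‖ ^ 2) ω =
        K - 2 * (2 * κ ^ 2 / ((Module.finrank ℝ E : ℝ) - 1)) *
          ⟪((ω k : sphere (0 : E) 1) : E), U k l (ω l : E)⟫ ^ 2 := by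
  have hlk : l ≠ k := fun h => hkl h.symm
  have hsub : ({k, l} : Finset Λ) ⊆ I :=
    Finset.insert_subset_iff.2 ⟨hkI, Finset.singleton_subset_iff.2 hlI⟩
  refine ⟨(∑ n ∈ I \ {k, l}, 2 * κ ^ 2 / ((Module.finrank ℝ E : ℝ) - 1) *
      ((1 - 1 / (Module.finrank ℝ E : ℝ)) *
        ((∑ m, ∑ i, ‖(if m ∈ ({k, l} : Finset Λ) then (0 : E →L[ℝ] E) else U n m)
            (stdOrthonormalBasis ℝ E i)‖ ^ 2) / (Module.finrank ℝ E : ℝ) + (β n k ^ 2 + β n l ^ 2)))) +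
    (2 * κ ^ 2 / ((Module.finrank ℝ E : ℝ) - 1) *
        ((∑ m, ∑ i, ‖(if m ∈ ({k, l} : Finset Λ) then (0 : E →L[ℝ] E) else U k m)
            (stdOrthonormalBasis ℝ E i)‖ ^ 2) / (Module.finrank ℝ E : ℝ) + β k l ^ 2 -
          (∑ m ∈ Finset.univ \ {k, l}, β m k ^ 2) / (Module.finrank ℝ E : ℝ)) +
      2 * κ ^ 2 / ((Module.finrank ℝ E : ℝ) - 1) *
        ((∑ m, ∑ i, ‖(if m ∈ ({l, k} : Finset Λ) then (0 : E →L[ℝ] E) else U l m)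
            (stdOrthonormalBasis ℝ E i)‖ ^ 2) / (Module.finrank ℝ E : ℝ) + β l k ^ 2 -
          (∑ m ∈ Finset.univ \ {l, k}, β m l ^ 2) / (Module.finrank ℝ E : ℝ))), fun ω => ?_⟩
  -- the site terms of the glued configuration are continuous in `ω'`, so `∫Σ = Σ∫`
  have hglue : Continuous fun ω' : Λ → sphere (0 : E) 1 => (Finset.univ \ {k, l}).piecewise ω' ω :=
    (continuous_piecewise_prod (Finset.univ \ {k, l})).comp (Continuous.prodMk_right ω)
  have hvc : ∀ n, Continuous fun η : Λ → sphere (0 : E) 1 => 2 * κ ^ 2 / ((Module.finrank ℝ E : ℝ) - 1) *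
      ‖tangentKick (localField U n (fun i => ((η i : sphere (0 : E) 1) : E))) (η n : E)‖ ^ 2 := by
    intro n
    have hJ : Continuous fun η : Λ → sphere (0 : E) 1 => localField U n (fun i => ((η i : sphere (0 : E) 1) : E)) :=
      (contDiff_localField U n (m := 0)).continuous.comp continuous_sphereConfig
    have hx : Continuous fun η : Λ → sphere (0 : E) 1 => ((η n : sphere (0 : E) 1) : E) :=
      continuous_subtype_val.comp (continuous_apply n)
    unfold tangentKick
    exact continuous_const.mul ((hJ.sub ((hJ.inner hx).smul hx)).norm.pow 2)
  have hint : ∀ n ∈ I, Integrable (fun ω' : Λ → sphere (0 : E) 1 =>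
      2 * κ ^ 2 / ((Module.finrank ℝ E : ℝ) - 1) *
        ‖tangentKick (localField U n (fun i => ((((Finset.univ \ {k, l}).piecewise ω' ω) i :
            sphere (0 : E) 1) : E))) ((((Finset.univ \ {k, l}).piecewise ω' ω) n : sphere (0 : E) 1) : E)‖ ^ 2)
      (Measure.pi fun _ : Λ => uniformSphere (volume : Measure E)) := fun n _ =>
    integrable_pi_of_continuous _ ((hvc n).comp hglue)
  unfold coordAvg
  simp only
  rw [integral_finsetSum I hint, ← Finset.sum_sdiff hsub, Finset.sum_pair hkl]
  -- far sites
  have hfar : ∀ n ∈ I \ {k, l}, ∫ ω', 2 * κ ^ 2 / ((Module.finrank ℝ E : ℝ) - 1) *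
      ‖tangentKick (localField U n (fun i => ((((Finset.univ \ {k, l}).piecewise ω' ω) i :
          sphere (0 : E) 1) : E))) ((((Finset.univ \ {k, l}).piecewise ω' ω) n : sphere (0 : E) 1) : E)‖ ^ 2
        ∂Measure.pi (fun _ : Λ => uniformSphere (volume : Measure E)) =
      2 * κ ^ 2 / ((Module.finrank ℝ E : ℝ) - 1) * ((1 - 1 / (Module.finrank ℝ E : ℝ)) *
        ((∑ m, ∑ i, ‖(if m ∈ ({k, l} : Finset Λ) then (0 : E →L[ℝ] E) else U n m)
            (stdOrthonormalBasis ℝ E i)‖ ^ 2) / (Module.finrank ℝ E : ℝ) + (β n k ^ 2 + β n l ^ 2))) := by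
    intro n hn
    have hn' : n ∈ I ∧ ¬ n = k ∧ ¬ n = l := by simpa [Finset.mem_sdiff] using hn
    exact integral_loCarreSite_pair_piecewise_far h2 hU0 hβ hkl hn'.2.1 hn'.2.2 (htri n) κ ω
  rw [Finset.sum_congr rfl hfar, integral_loCarreSite_pair_piecewise_near h2 hU0 hUadj hβ hkl κ ω]
  -- the pinned site `l`: the same lemma with the roles of `k` and `l` exchanged
  have hl := integral_loCarreSite_pair_piecewise_near h2 hU0 hUadj hβ hlk κ ω
  rw [Finset.pair_comm l k] at hl
  have hξ : ⟪((ω l : sphere (0 : E) 1) : E), U l k (ω k : E)⟫ = ⟪((ω k : sphere (0 : E) 1) : E), U k l (ω l : E)⟫ := by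
    rw [← hUadj k l, real_inner_comm]
  rw [hξ] at hl
  rw [hl, Finset.pair_comm l k]
  ring

/-- **THE CONDITIONAL VARIANCE GIVEN A COUPLED PAIR**: under the same hypotheses
`Var_π̄(A_{Λ∖{k,l}} V_I) = Var(E[V_I | ω_k, ω_l]) = 4·(2κ²/(d−1))²·Var_π̄(⟪ω_k, U_{kl} ω_l⟫²)` — a
flow-free, volume-free two-spin integral (its value `2(d−1)β_{kl}⁴/(d²(d+2))` is the tree's
`Exactness/SphereLatticeFourthMoment`). -/
theorem variance_coordAvg_pair_loCarreBlock_eq (h2 : 2 ≤ Module.finrank ℝ E) (hU0 : ∀ n, U n n = 0)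
    (hUadj : ∀ m n (v w : E), ⟪U m n v, w⟫ = ⟪v, U n m w⟫)
    (hβ : ∀ n m (v : E), ‖U n m v‖ = β n m * ‖v‖) (hkl : k ≠ l) (htri : ∀ n, U n k = 0 ∨ U n l = 0)
    {I : Finset Λ} (hkI : k ∈ I) (hlI : l ∈ I) (κ : ℝ) :
    ∫ ω, (coordAvg (uniformSphere (volume : Measure E)) (Finset.univ \ {k, l}) (fun ω => ∑ n ∈ I,
          2 * κ ^ 2 / ((Module.finrank ℝ E : ℝ) - 1) *
            ‖tangentKick (localField U n (fun i => ((ω i : sphere (0 : E) 1) : E))) (ω n : E)‖ ^ 2) ω -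
          ∫ ω', (∑ n ∈ I, 2 * κ ^ 2 / ((Module.finrank ℝ E : ℝ) - 1) *
            ‖tangentKick (localField U n (fun i => ((ω' i : sphere (0 : E) 1) : E))) (ω' n : E)‖ ^ 2)
            ∂Measure.pi (fun _ : Λ => uniformSphere (volume : Measure E))) ^ 2
          ∂Measure.pi (fun _ : Λ => uniformSphere (volume : Measure E)) =
      4 * (2 * κ ^ 2 / ((Module.finrank ℝ E : ℝ) - 1)) ^ 2 *
        ∫ ω, (⟪((ω k : sphere (0 : E) 1) : E), U k l (ω l : E)⟫ ^ 2 -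
            ∫ ω', ⟪((ω' k : sphere (0 : E) 1) : E), U k l (ω' l : E)⟫ ^ 2
              ∂Measure.pi (fun _ : Λ => uniformSphere (volume : Measure E))) ^ 2
          ∂Measure.pi (fun _ : Λ => uniformSphere (volume : Measure E)) := by
  obtain ⟨K, hK⟩ := coordAvg_pair_loCarreBlock_eq h2 hU0 hUadj hβ hkl htri hkI hlI κ
  set a : ℝ := 2 * κ ^ 2 / ((Module.finrank ℝ E : ℝ) - 1) with ha
  have hξc : Continuous fun ω : Λ → sphere (0 : E) 1 => ⟪((ω k : sphere (0 : E) 1) : E), U k l (ω l : E)⟫ ^ 2 :=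
    ((continuous_subtype_val.comp (continuous_apply k)).inner
      ((U k l).continuous.comp (continuous_subtype_val.comp (continuous_apply l)))).pow 2
  have hVc : Continuous fun η : Λ → sphere (0 : E) 1 => ∑ n ∈ I, a *
      ‖tangentKick (localField U n (fun i => ((η i : sphere (0 : E) 1) : E))) (η n : E)‖ ^ 2 := by
    refine continuous_finsetSum I fun n _ => ?_
    have hJ : Continuous fun η : Λ → sphere (0 : E) 1 => localField U n (fun i => ((η i : sphere (0 : E) 1) : E)) :=
      (contDiff_localField U n (m := 0)).continuous.comp continuous_sphereConfig
    have hx : Continuous fun η : Λ → sphere (0 : E) 1 => ((η n : sphere (0 : E) 1) : E) :=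
      continuous_subtype_val.comp (continuous_apply n)
    unfold tangentKick
    exact continuous_const.mul ((hJ.sub ((hJ.inner hx).smul hx)).norm.pow 2)
  -- the mean of the block term is the mean of its conditional mean
  have hmean : ∫ ω', (∑ n ∈ I, a *
      ‖tangentKick (localField U n (fun i => ((ω' i : sphere (0 : E) 1) : E))) (ω' n : E)‖ ^ 2)
        ∂Measure.pi (fun _ : Λ => uniformSphere (volume : Measure E)) =
      K - 2 * a * ∫ ω', ⟪((ω' k : sphere (0 : E) 1) : E), U k l (ω' l : E)⟫ ^ 2
        ∂Measure.pi (fun _ : Λ => uniformSphere (volume : Measure E)) := by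
    rw [← integral_coordAvg (uniformSphere (volume : Measure E)) (Finset.univ \ {k, l}) hVc]
    simp_rw [hK]
    have hIξ : Integrable (fun ω' : Λ → sphere (0 : E) 1 =>
        2 * a * ⟪((ω' k : sphere (0 : E) 1) : E), U k l (ω' l : E)⟫ ^ 2)
        (Measure.pi fun _ : Λ => uniformSphere (volume : Measure E)) :=
      (integrable_pi_of_continuous _ hξc).const_mul _
    rw [integral_sub (integrable_const K) hIξ, integral_const, smul_eq_mul, probReal_univ, one_mul,
      integral_const_mul]
  simp_rw [hK, hmean]
  have hsq : ∀ ω : Λ → sphere (0 : E) 1,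
      (K - 2 * a * ⟪((ω k : sphere (0 : E) 1) : E), U k l (ω l : E)⟫ ^ 2 -
          (K - 2 * a * ∫ ω', ⟪((ω' k : sphere (0 : E) 1) : E), U k l (ω' l : E)⟫ ^ 2
            ∂Measure.pi (fun _ : Λ => uniformSphere (volume : Measure E)))) ^ 2 =
        4 * a ^ 2 * (⟪((ω k : sphere (0 : E) 1) : E), U k l (ω l : E)⟫ ^ 2 -
          ∫ ω', ⟪((ω' k : sphere (0 : E) 1) : E), U k l (ω' l : E)⟫ ^ 2
            ∂Measure.pi (fun _ : Λ => uniformSphere (volume : Measure E))) ^ 2 := by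
    intro ω; ring
  simp_rw [hsq]
  rw [integral_const_mul]

end Pair

end Summit.Ventures.LatticeQCDFlow.Exactness

end
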